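import Summits.RiemannHypothesis.RiemannHypothesis.Theorems.Splittings.LiSecondOrderCriterion
import HarnessLib

/-!
# Complex-coefficient trigonometric sums on the unit circle take BOTH signs, with a margin, in every window (li-bridge g7 SketchG7 §1)

Cell rh-split, seat rh-split-li-bridge g7 (brief sha16 f79c5f09d8bcb036), card `run/shared/lean/pub/rh-split/cards/SPLIT-li-bridge.md` §14
(referee rh-split-ref g5: REPLAY PASS of v1 353a9a80816aea0e + v2 ca059ef508c1d3b5, 08:37:53Z; labels L1–L4 there); kernel source
`HOME/rh-split-li-bridge/SketchG7.lean` sha16 dac2b83ce457a730 (1546 l; = v2 + §5e `not_tendsto_liSecondDiff/_liFdiff` + 28 one-line docstrings,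
no decl text changed).  Cut by the seat (lead RULING #60, lane (xi-g)) into SIX tree modules at the scratch's section boundaries, decl text
byte-verbatim; deltas = namespace `RhSplit.LiBridgeG7` ↦ `…Theorems.Splittings.{LiWindowComplex, LiCurvatureSignChanges, LiDifferenceOrderLaw}`
(+ `open` of the earlier namespaces of the chain), module docstrings, and the variable-free wrapper `section HigherOrder … end HigherOrder`
dropped.  END-TO-END statement of the chain (last file): `LiDifferenceOrderLaw.liFdiff_signs_syndetic (hK : 2 ≤ K) :
∃ η > 0, ∃ L, ∀ N, (∃ n ∈ Ico N (N+L), fdiff K keiperLiCoeff n ≤ −η) ∧ (∃ n ∈ Ico N (N+L), η ≤ fdiff K keiperLiCoeff n)` — every forward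
difference of order `K ≥ 2` of Li's coefficients (K = 2: the curvature `d_n = λ_{n+2} − 2λ_{n+1} + λ_n`, file `LiCurvatureSignChanges`) takes
BOTH signs with a margin on a syndetic set, UNCONDITIONALLY (proof by cases on `RiemannHypothesis`; an RH-free kernel theorem about `λ_n`
alone, referee label L1; certifies nothing about RH; class (li, bridge) unchanged).

This file: §1 (pure harmonic analysis, RH-free): objects `ctrigSum cmass csqMass cmeanConst cvarConst cwindowLen cmargin`; `cwindow_two_signs` — a finite sum
`g(n) = Σ_{i∈E} Re(c_i u_iⁿ)` with `‖u_i‖ = 1`, `u_i ≠ 1` and sign-coherent resonant pairs (`u_i u_j = 1 ⟹ 0 ≤ Re(c_i c_j)`, `u_i = u_j ⟹ 0 ≤ Re(c_i c̄_j)`)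
takes a value `≥ η` AND a value `≤ −η` in EVERY window `[N, N+L₀)`, `η = cmargin = σ²/(8M)`, `L₀ = cwindowLen` (the tree's positive-weight
`LiExtremalLayer.window_two_signs` is the case `c_i = m_i > 0`).

HONEST LABEL: «SPLITTING SEARCH over kernel-typed RH-EQUIVALENCES; a splitting A ∧ B ⟹ RH is CONDITIONAL bookkeeping unless A and B are
both proved; nothing here bears on the truth of RH.»
-/

set_option linter.dupNamespace false

noncomputable section

namespace Summit.RiemannHypothesis.RiemannHypothesis.Theorems.Splittings.LiWindowComplex

open Complex Filter Topology Finset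
open scoped Real ComplexConjugate
open Literature.NumberTheory.LFunctions
open Summit.RiemannHypothesis.RiemannHypothesis.Theorems.Splittings
open Summit.RiemannHypothesis.RiemannHypothesis.Theorems.Splittings.LiIndexSets
open Summit.RiemannHypothesis.RiemannHypothesis.Theorems.Splittings.LiExtremalLayer
open Summit.RiemannHypothesis.RiemannHypothesis.Theorems.Splittings.LiSecondOrderCriterion

/-! ## §1 Complex-coefficient trigonometric sums on the unit circle: both signs, with a margin, in every window -/

section Window

variable {ι : Type*}

/-- `g(n) = Σ_{i ∈ E} Re(c_i · u_iⁿ)`. -/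
def ctrigSum (E : Finset ι) (c : ι → ℂ) (u : ι → ℂ) (n : ℕ) : ℝ := ∑ i ∈ E, (c i * u i ^ n).re

/-- `M = Σ ‖c_i‖`. -/
def cmass (E : Finset ι) (c : ι → ℂ) : ℝ := ∑ i ∈ E, ‖c i‖

/-- `σ² = Σ ‖c_i‖²`. -/
def csqMass (E : Finset ι) (c : ι → ℂ) : ℝ := ∑ i ∈ E, ‖c i‖ ^ 2

/-- `C₁ = Σ_i ‖c_i‖ · 2/‖1 − u_i‖`. -/
def cmeanConst (E : Finset ι) (c : ι → ℂ) (u : ι → ℂ) : ℝ := ∑ i ∈ E, ‖c i‖ * (2 / ‖1 - u i‖)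

/-- `C₂ = Σ_{i,j} ‖c_i‖‖c_j‖ (1/‖1 − u_i u_j‖ + 1/‖1 − u_i ū_j‖)` (resonant pairs contribute `1/0 = 0`). -/
def cvarConst (E : Finset ι) (c : ι → ℂ) (u : ι → ℂ) : ℝ :=
  ∑ i ∈ E, ∑ j ∈ E, ‖c i‖ * ‖c j‖ * (1 / ‖1 - u i * u j‖ + 1 / ‖1 - u i * conj (u j)‖)

/-- `L₀ = ⌈4(C₂ + M C₁)/σ²⌉₊ + 1`. -/
def cwindowLen (E : Finset ι) (c : ι → ℂ) (u : ι → ℂ) : ℕ :=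
  ⌈4 * (cvarConst E c u + cmass E c * cmeanConst E c u) / csqMass E c⌉₊ + 1

/-- `η = σ²/(8M)`. -/
def cmargin (E : Finset ι) (c : ι → ℂ) : ℝ := csqMass E c / (8 * cmass E c)

variable {E : Finset ι} {c : ι → ℂ} {u : ι → ℂ}

/-- `Re(a · Σ_{n ∈ [N,N+L)} vⁿ) ≥ −‖a‖ · 2/‖1 − v‖` for `‖v‖ ≤ 1` — INCLUDING the resonant case `v = 1`
provided `Re a ≥ 0` there (then the window sum is `L` and `2/‖1 − 1‖ = 0`). -/
theorem neg_le_re_mul_sum_Ico_pow {a v : ℂ} (hv : ‖v‖ ≤ 1) (hres : v = 1 → 0 ≤ a.re) (N L : ℕ) :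
    -(‖a‖ * (2 / ‖1 - v‖)) ≤ (a * ∑ n ∈ Ico N (N + L), v ^ n).re := by
  by_cases hv1 : v = 1
  · subst hv1
    have h0 := hres rfl
    simp only [one_pow, Finset.sum_const, Nat.card_Ico, nsmul_eq_mul, mul_one, sub_self, norm_zero,
      div_zero, mul_zero, neg_zero]
    rw [Complex.mul_re, Complex.natCast_re, Complex.natCast_im, mul_zero, sub_zero]
    exact mul_nonneg h0 (Nat.cast_nonneg _)
  · have h : |(a * ∑ n ∈ Ico N (N + L), v ^ n).re| ≤ ‖a‖ * (2 / ‖1 - v‖) := by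
      refine (abs_re_le_norm _).trans ?_
      rw [norm_mul]
      exact mul_le_mul_of_nonneg_left (norm_sum_Ico_pow_le hv hv1 N L) (norm_nonneg _)
    exact (abs_le.1 h).1

/-- `|g(n)| ≤ M`. -/
theorem abs_ctrigSum_le (hu : ∀ i ∈ E, ‖u i‖ = 1) (n : ℕ) : |ctrigSum E c u n| ≤ cmass E c := by
  unfold ctrigSum cmass
  refine (Finset.abs_sum_le_sum_abs _ _).trans (Finset.sum_le_sum fun i hi ↦ ?_)
  refine (abs_re_le_norm _).trans ?_
  rw [norm_mul, norm_pow, hu i hi, one_pow, mul_one]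

/-- `|Σ_{n ∈ [N,N+L)} g(n)| ≤ C₁`. -/
theorem abs_sum_ctrigSum_le (hu : ∀ i ∈ E, ‖u i‖ = 1) (hu1 : ∀ i ∈ E, u i ≠ 1) (N L : ℕ) :
    |∑ n ∈ Ico N (N + L), ctrigSum E c u n| ≤ cmeanConst E c u := by
  unfold ctrigSum cmeanConst
  rw [Finset.sum_comm]
  refine (Finset.abs_sum_le_sum_abs _ _).trans (Finset.sum_le_sum fun i hi ↦ ?_)
  rw [← Complex.re_sum, ← Finset.mul_sum]
  refine (abs_re_le_norm _).trans ?_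
  rw [norm_mul]
  exact mul_le_mul_of_nonneg_left (norm_sum_Ico_pow_le (hu i hi).le (hu1 i hi) N L) (norm_nonneg _)

/-- `σ² > 0 ⟹ M > 0`. -/
theorem cmass_pos (hσ : 0 < csqMass E c) : 0 < cmass E c := by
  by_contra h
  push Not at h
  have h0 : cmass E c = 0 := le_antisymm h (Finset.sum_nonneg fun i _ ↦ norm_nonneg _)
  have hall := (Finset.sum_eq_zero_iff_of_nonneg (fun i _ ↦ norm_nonneg (c i))).1 h0
  have : csqMass E c = 0 := Finset.sum_eq_zero fun i hi ↦ by rw [hall i hi]; simp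
  linarith

/-- `η = σ²/(8M) > 0`. -/
theorem cmargin_pos (hσ : 0 < csqMass E c) : 0 < cmargin E c :=
  div_pos hσ (by have := cmass_pos hσ; positivity)

/-- **Window mean square.** `(L/2)σ² − C₂ ≤ Σ_{n ∈ [N,N+L)} g(n)²` when the resonant pairs are sign-coherent. -/
theorem sum_ctrigSum_sq_ge (hu : ∀ i ∈ E, ‖u i‖ = 1)
    (hres : ∀ i ∈ E, ∀ j ∈ E, u i * u j = 1 → 0 ≤ (c i * c j).re)
    (hres' : ∀ i ∈ E, ∀ j ∈ E, u i = u j → 0 ≤ (c i * conj (c j)).re) (N L : ℕ) :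
    (L : ℝ) / 2 * csqMass E c - cvarConst E c u ≤ ∑ n ∈ Ico N (N + L), ctrigSum E c u n ^ 2 := by
  classical
  have hexp : ∀ n, ctrigSum E c u n ^ 2 =
      ∑ i ∈ E, ∑ j ∈ E, (((c i * c j) * (u i * u j) ^ n).re +
        ((c i * conj (c j)) * (u i * conj (u j)) ^ n).re) / 2 := by
    intro n
    rw [ctrigSum, sq, Finset.sum_mul_sum]
    refine Finset.sum_congr rfl fun i _ ↦ Finset.sum_congr rfl fun j _ ↦ ?_
    have e1 : c i * u i ^ n * (c j * u j ^ n) = (c i * c j) * (u i * u j) ^ n := by ring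
    have e2 : c i * u i ^ n * (conj (c j) * conj (u j) ^ n) = (c i * conj (c j)) * (u i * conj (u j)) ^ n := by
      ring
    rw [re_mul_re, map_mul, map_pow, e1, e2]
  have key : ∑ n ∈ Ico N (N + L), ctrigSum E c u n ^ 2 =
      ∑ i ∈ E, ∑ j ∈ E, (((c i * c j) * ∑ n ∈ Ico N (N + L), (u i * u j) ^ n).re +
        ((c i * conj (c j)) * ∑ n ∈ Ico N (N + L), (u i * conj (u j)) ^ n).re) / 2 := by
    simp_rw [hexp]
    rw [Finset.sum_comm]
    refine Finset.sum_congr rfl fun i _ ↦ ?_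
    rw [Finset.sum_comm]
    refine Finset.sum_congr rfl fun j _ ↦ ?_
    rw [← Finset.sum_div, Finset.sum_add_distrib, ← Complex.re_sum, ← Complex.re_sum, ← Finset.mul_sum,
      ← Finset.mul_sum]
  rw [key]
  have hterm : ∀ i ∈ E, ∀ j ∈ E,
      -(‖c i‖ * ‖c j‖ * (1 / ‖1 - u i * u j‖ + 1 / ‖1 - u i * conj (u j)‖)) +
          (if i = j then ‖c i‖ ^ 2 * ((L : ℝ) / 2) else 0) ≤
        (((c i * c j) * ∑ n ∈ Ico N (N + L), (u i * u j) ^ n).re +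
          ((c i * conj (c j)) * ∑ n ∈ Ico N (N + L), (u i * conj (u j)) ^ n).re) / 2 := by
    intro i hi j hj
    have hij1 : ‖u i * u j‖ ≤ 1 := by rw [norm_mul, hu i hi, hu j hj, one_mul]
    have hij2 : ‖u i * conj (u j)‖ ≤ 1 := by rw [norm_mul, Complex.norm_conj, hu i hi, hu j hj, one_mul]
    have hA := neg_le_re_mul_sum_Ico_pow (a := c i * c j) hij1 (hres i hi j hj) N L
    have hB' : u i * conj (u j) = 1 → 0 ≤ (c i * conj (c j)).re := by
      intro h1
      apply hres' i hi j hj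
      have hcc : conj (u j) * u j = 1 := by
        rw [mul_comm, Complex.mul_conj, Complex.normSq_eq_norm_sq, hu j hj]; simp
      calc u i = u i * (conj (u j) * u j) := by rw [hcc, mul_one]
        _ = (u i * conj (u j)) * u j := by ring
        _ = u j := by rw [h1, one_mul]
    have hB := neg_le_re_mul_sum_Ico_pow (a := c i * conj (c j)) hij2 hB' N L
    rw [norm_mul] at hA hB
    rw [Complex.norm_conj] at hB
    rw [div_eq_mul_one_div] at hA hB
    have hcc0 : 0 ≤ ‖c i‖ * ‖c j‖ := mul_nonneg (norm_nonneg _) (norm_nonneg _)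
    by_cases hij : i = j
    · subst hij
      have hone : u i * conj (u i) = 1 := by
        rw [Complex.mul_conj, Complex.normSq_eq_norm_sq, hu i hi]; simp
      have hre : ((c i * conj (c i)) * ∑ n ∈ Ico N (N + L), (u i * conj (u i)) ^ n).re = ‖c i‖ ^ 2 * L := by
        rw [hone]
        simp only [one_pow, Finset.sum_const, Nat.card_Ico, nsmul_eq_mul, mul_one, Complex.mul_conj,
          Complex.normSq_eq_norm_sq]
        have hL : ((N + L - N : ℕ) : ℂ) = (L : ℂ) := by rw [Nat.add_sub_cancel_left]
        rw [hL, ← Complex.ofReal_natCast, ← Complex.ofReal_mul, Complex.ofReal_re]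
      rw [if_pos rfl, hre]
      rw [hone, sub_self, norm_zero, div_zero, add_zero]
      have e : ‖c i‖ ^ 2 = ‖c i‖ * ‖c i‖ := sq _
      rw [e] at hre ⊢
      linarith
    · rw [if_neg hij, add_zero]
      linarith
  calc (L : ℝ) / 2 * csqMass E c - cvarConst E c u
      = ∑ i ∈ E, ∑ j ∈ E, (-(‖c i‖ * ‖c j‖ * (1 / ‖1 - u i * u j‖ + 1 / ‖1 - u i * conj (u j)‖)) +
          (if i = j then ‖c i‖ ^ 2 * ((L : ℝ) / 2) else 0)) := by
        simp only [Finset.sum_add_distrib, Finset.sum_neg_distrib, Finset.sum_ite_eq, csqMass, cvarConst]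
        have : ∑ i ∈ E, (if i ∈ E then ‖c i‖ ^ 2 * ((L : ℝ) / 2) else 0) =
            (∑ i ∈ E, ‖c i‖ ^ 2) * ((L : ℝ) / 2) := by
          rw [Finset.sum_mul]; exact Finset.sum_congr rfl fun i hi ↦ by rw [if_pos hi]
        rw [this]
        ring
    _ ≤ _ := Finset.sum_le_sum fun i hi ↦ Finset.sum_le_sum fun j hj ↦ hterm i hi j hj

/-- **Complex-coefficient window theorem.**  `g(n) = Σ_{i∈E} Re(c_i u_iⁿ)` on the unit circle, no `u_i = 1`,
resonant pairs sign-coherent, `σ² > 0`: `g` takes a value `≥ η` AND a value `≤ −η` in every window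
`[N, N + L₀)`, `η = σ²/(8M)`, `L₀ = ⌈4(C₂ + M C₁)/σ²⌉ + 1`. -/
theorem cwindow_two_signs (hu : ∀ i ∈ E, ‖u i‖ = 1) (hu1 : ∀ i ∈ E, u i ≠ 1)
    (hres : ∀ i ∈ E, ∀ j ∈ E, u i * u j = 1 → 0 ≤ (c i * c j).re)
    (hres' : ∀ i ∈ E, ∀ j ∈ E, u i = u j → 0 ≤ (c i * conj (c j)).re)
    (hσ : 0 < csqMass E c) (N : ℕ) :
    (∃ n ∈ Ico N (N + cwindowLen E c u), cmargin E c ≤ ctrigSum E c u n) ∧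
    (∃ n ∈ Ico N (N + cwindowLen E c u), ctrigSum E c u n ≤ -cmargin E c) := by
  have hM : 0 < cmass E c := cmass_pos hσ
  have hη : 0 < cmargin E c := cmargin_pos hσ
  set L := cwindowLen E c u with hLdef
  have hLgt : 4 * (cvarConst E c u + cmass E c * cmeanConst E c u) / csqMass E c < L := by
    rw [hLdef, cwindowLen, Nat.cast_add, Nat.cast_one]
    exact (Nat.le_ceil _).trans_lt (lt_add_one _)
  have hL' : 4 * (cvarConst E c u + cmass E c * cmeanConst E c u) < L * csqMass E c := by
    rwa [div_lt_iff₀ hσ] at hLgt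
  have hsq := sum_ctrigSum_sq_ge hu hres hres' N L
  have hmean := abs_sum_ctrigSum_le (c := c) hu hu1 N L
  have habs : ∀ n, |ctrigSum E c u n| ≤ cmass E c := fun n ↦ abs_ctrigSum_le hu n
  have hcard : ((Ico N (N + L)).card : ℝ) = L := by simp
  have h3 : cmass E c * (2 * cmargin E c) = csqMass E c / 4 := by
    rw [cmargin]; field_simp; ring
  constructor
  · by_contra h
    push Not at h
    have hpt : ∀ n ∈ Ico N (N + L),
        ctrigSum E c u n ^ 2 ≤ csqMass E c / 4 - cmass E c * ctrigSum E c u n := by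
      intro n hn
      have := sq_le_of_lt (habs n) hη (h n hn)
      rwa [mul_sub, h3] at this
    have hsum := Finset.sum_le_sum hpt
    rw [Finset.sum_sub_distrib, Finset.sum_const, nsmul_eq_mul, hcard, ← Finset.mul_sum] at hsum
    have h5 := mul_le_mul_of_nonneg_left (abs_le.1 hmean).1 hM.le
    linarith
  · by_contra h
    push Not at h
    have hpt : ∀ n ∈ Ico N (N + L),
        ctrigSum E c u n ^ 2 ≤ csqMass E c / 4 + cmass E c * ctrigSum E c u n := by
      intro n hn
      have := sq_le_of_gt (habs n) hη (h n hn)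
      rwa [mul_add, h3] at this
    have hsum := Finset.sum_le_sum hpt
    rw [Finset.sum_add_distrib, Finset.sum_const, nsmul_eq_mul, hcard, ← Finset.mul_sum] at hsum
    have h5 := mul_le_mul_of_nonneg_left (abs_le.1 hmean).2 hM.le
    linarith

end Window

end Summit.RiemannHypothesis.RiemannHypothesis.Theorems.Splittings.LiWindowComplex

end
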